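import Summits.ResolutionOfSingularities.ResolutionOfSingularities.Theorems.WeightedInvariantELadderTwoInducedAtlasCover
import HarnessLib

/-!
# E-ladder rung `e = 2`, step piece (S-b1) — part 3: the induced atlas WITH THE LIFT `σ_X` and `q' ≫ ρ = σ_X ≫ q`

[OURS · L1 W4.3 · DOOR `HypersurfaceCentreConstruction` (stmt-ResolutionOfSingularities-19897) · E2 STEP piece (S-b1)
of the registrar's SPEC (Δ6b) (rev 5 source), ORDER/OFFER (o59-b1); written by res-D-pv-048 (gen 11); companion of
`…ELadderTwoInducedAtlas` (part 1: body verbatim) and `…ELadderTwoInducedAtlasCover` (part 2: chart map, cover, units,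
dictionary).  Def-free kernel lemma; `--supports` the door item as a helper.  Replaces the role of: nothing printed —
OURS bookkeeping of the E-ladder, NOT a statement of the manuscript [Hironaka2017] or of any manuscript under
adjudication; candidates not facts; AI work, weaker than expert review.]

WHY A PART 3.  The (S-b2) descent of orbit-genericity (read points over read points) runs: orbit-generic at a unit
chart ⇔ homogeneous prime ∧ CLOSED quotient point; homogeneity is pulled back along the graded `σ₊♯` (part 2's cover
and units clauses), closedness is pushed down along the PROPER `ρ : V' ⟶ V` — which needs `q (σ_X x') = ρ (q' x')`.
A successor `Stage` only remembers `q' ≫ ρ ≫ g = i' ≫ σ₊ ≫ f`, which does not determine `q' ≫ ρ`.  The construction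
knows `q' ≫ ρ = σ_X ≫ q` (`q'` IS the lift of `σ_X ≫ q` along the blow-up `ρ`); this file exposes it:
`LocalEngine.e2InducedAtlas_cover_lift` = part 2's `e2InducedAtlas_cover` + `IsBlowup ρ K` + `(σ_X, σ_X ≫ i = i' ≫ σ₊,
q' ≫ ρ = σ_X ≫ q)`.  No re-run of the construction (the generic
`DatumToEmbedded.Atlas.gradedAtlas_succ_cover_of_isRegularWeightedCentre` takes `σ_X`, `q'`, `hq'` as inputs).
-/

noncomputable section

open CategoryTheory CategoryTheory.Limits AlgebraicGeometry TopologicalSpace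
open Literature.AlgebraicGeometry.Resolution
open Summit.ResolutionOfSingularities.ResolutionOfSingularities.Theorems

set_option linter.dupNamespace false -- mandated namespace of this single-conjunct summit

/-! ## (S-b1) for a stage, with the lift -/

namespace Summit.ResolutionOfSingularities.ResolutionOfSingularities.Cruxes.HypersurfaceCentreConstruction.LocalEngine

open Summit.ResolutionOfSingularities.ResolutionOfSingularities.Theorems.ELadderOne

/-- **(S-b1) STRUCTURED SUCCESSOR ATLAS — chart map, cover, unit transfer, dictionary, AND THE LIFT `σ_X` WITH
`q' ≫ ρ = σ_X ≫ q`, for a stage over any field.**  As `e2InducedAtlas_cover`, exposing in addition the morphism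
`σ_X : X' ⟶ X` of the strict transform to the hypersurface (`σ_X ≫ i = i' ≫ σ₊`, the lift along the closed immersion
`i`) and the pointwise compatibility of the quotients `q' ≫ ρ = σ_X ≫ q` (the lift of `IsBlowup`): the successor's
Stage field `q' ≫ ρ ≫ g = i' ≫ σ₊ ≫ f` alone does not determine `q' ≫ ρ`, and the (S-b2) descent pushes closedness of
quotient points down along the proper `ρ`. [cite: Wlodarczyk2022, §2.3.3 and Thm 1.1.4 (5)] -/
theorem e2InducedAtlas_cover_lift {k : Type} [Field k] (S : Stage k)
    (R : ReesAlgebraData S.Y) (hadm : IsAdmissibleCentre S.f S.i.ker R) (hξ : S.i (genericPoint S.X) ∉ R.support)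
    (R' : ReesFiltration S.Y) (hR' : R'.ideal = R.piece)
    [Smooth (R'.πPlus ≫ S.f)] [IsSeparated (R'.πPlus ≫ S.f)] [QuasiCompact (R'.πPlus ≫ S.f)]
    [IsIntegral (R'.strictTransformPlus S.i.ker).subscheme] :
    ∃ (Dg : ℕ), 0 < Dg ∧
    ∃ (V' : Scheme.{0}) (ρ : V' ⟶ S.V) (_ : IsIntegral V') (_ : IsProper ρ)
      (_ : IsBlowup ρ ((((R.piece Dg).comap S.i).subschemeι ≫ S.q).ker))
      (q' : (R'.strictTransformPlus S.i.ker).subscheme ⟶ V')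
      (_ : q' ≫ ρ ≫ S.g = (R'.strictTransformPlus S.i.ker).subschemeι ≫ R'.πPlus ≫ S.f)
      (σX : (R'.strictTransformPlus S.i.ker).subscheme ⟶ S.X)
      (_ : σX ≫ S.i = (R'.strictTransformPlus S.i.ker).subschemeι ≫ R'.πPlus)
      (_ : q' ≫ ρ = σX ≫ S.q),
      ∃ (𝒜' : GradedAtlas (S.j + 1) (R'.πPlus ≫ S.f) (R'.strictTransformPlus S.i.ker).subschemeι q')
        (oc : 𝒜'.ι → S.atlas.ι)
        (hle : ∀ a' : 𝒜'.ι,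
          (𝒜'.W a' : (R'.plus : Scheme.{0}).Opens) ≤ R'.πPlus ⁻¹ᵁ (S.atlas.W (oc a') : S.Y.Opens)),
        -- uniform exponent of the successor atlas
        𝒜'.exponent = S.atlas.exponent * Dg ∧
        -- COVER: over every old chart through `σ₊ (i' x')` there is a successor chart through `i' x'`
        (∀ (x' : ↥(R'.strictTransformPlus S.i.ker).subscheme) (a : S.atlas.ι),
          R'.πPlus.base ((R'.strictTransformPlus S.i.ker).subschemeι.base x') ∈ (S.atlas.W a : S.Y.Opens) →
          ∃ a' : 𝒜'.ι, oc a' = a ∧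
            (R'.strictTransformPlus S.i.ker).subschemeι.base x' ∈ (𝒜'.W a' : (R'.plus : Scheme.{0}).Opens)) ∧
        -- UNITS: a unit chart below gives a unit chart above (all degrees in `(e Dg)·ℤʲ⁺¹`)
        (∀ (a' : 𝒜'.ι) (e : ℕ),
          (∀ χ : Fin S.j → ℤ, ∃ s ∈ S.atlas.piece (oc a') (e • χ), IsUnit (S.i.app (S.atlas.W (oc a')) s)) →
          ∀ χ' : Fin (S.j + 1) → ℤ, ∃ s' ∈ 𝒜'.piece a' ((e * Dg) • χ'),
            IsUnit ((R'.strictTransformPlus S.i.ker).subschemeι.app (𝒜'.W a') s')) ∧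
        -- DICTIONARY of the chart `a'` over `oc a'`
        ∀ a' : 𝒜'.ι,
          (∀ (χ : Fin S.j → ℤ) (s : Γ(S.Y, S.atlas.W (oc a'))), s ∈ S.atlas.piece (oc a') χ →
            R'.πPlus.appLE (S.atlas.W (oc a')) (𝒜'.W a') (hle a') s ∈
              𝒜'.piece a' (Fin.snoc (α := fun _ => ℤ) χ 0)) ∧
          tInvOn R' (𝒜'.W a') ∈ 𝒜'.piece a' (Fin.snoc (α := fun _ => ℤ) 0 (-1)) ∧
          ∃ (β : Γ(S.Y, S.atlas.W (oc a'))) (η : Γ((R'.plus : Scheme.{0}), 𝒜'.W a')),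
            β ∈ (R.piece Dg).ideal (S.atlas.W (oc a')) ∧ β ∈ S.atlas.piece (oc a') 0 ∧ IsUnit η ∧
            η ∈ 𝒜'.piece a' (Fin.snoc (α := fun _ => ℤ) 0 (Dg : ℤ)) ∧
            η * tInvOn R' (𝒜'.W a') ^ Dg = R'.πPlus.appLE (S.atlas.W (oc a')) (𝒜'.W a') (hle a') β ∧
            -- the chart is the locus over `W (oc a')` where `σ₊♯ β = unit · (t⁻¹)^{Dg}`
            (∀ y' : (R'.plus : Scheme.{0}), y' ∈ (𝒜'.W a' : (R'.plus : Scheme.{0}).Opens) ↔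
              ∃ (O : (R'.plus : Scheme.{0}).affineOpens)
                (hO : (O : (R'.plus : Scheme.{0}).Opens) ≤ R'.πPlus ⁻¹ᵁ (S.atlas.W (oc a') : S.Y.Opens)),
                y' ∈ (O : (R'.plus : Scheme.{0}).Opens) ∧ ∃ η₀ : Γ((R'.plus : Scheme.{0}), O),
                  IsUnit η₀ ∧ η₀ * tInvOn R' O ^ Dg = R'.πPlus.appLE (S.atlas.W (oc a')) O hO β) ∧
            -- every degree-`0` section is `x t^{Dg l} / η^l` with `x ∈ R_{Dg l}(W (oc a'))` of degree `0` …
            (∀ s ∈ 𝒜'.piece a' 0, ∃ (l : ℕ) (x : Γ(S.Y, S.atlas.W (oc a'))),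
              x ∈ (R.piece (Dg * l)).ideal (S.atlas.W (oc a')) ∧ x ∈ S.atlas.piece (oc a') 0 ∧
                s * η ^ l * tInvOn R' (𝒜'.W a') ^ (Dg * l) =
                  R'.πPlus.appLE (S.atlas.W (oc a')) (𝒜'.W a') (hle a') x) ∧
            -- … and conversely
            (∀ (l : ℕ) (x : Γ(S.Y, S.atlas.W (oc a'))), x ∈ (R.piece (Dg * l)).ideal (S.atlas.W (oc a')) →
              x ∈ S.atlas.piece (oc a') 0 → ∃ s ∈ 𝒜'.piece a' 0,
                s * η ^ l * tInvOn R' (𝒜'.W a') ^ (Dg * l) =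
                  R'.πPlus.appLE (S.atlas.W (oc a')) (𝒜'.W a') (hle a') x) ∧
            -- strict-transform reading: `σ₊♯ x ∈ I'(W' a')  ⇒  x β ∈ I(W (oc a'))`
            (∀ x : Γ(S.Y, S.atlas.W (oc a')), R'.πPlus.appLE (S.atlas.W (oc a')) (𝒜'.W a') (hle a') x ∈
              (R'.strictTransformPlus S.i.ker).ideal (𝒜'.W a') → x * β ∈ S.i.ker.ideal (S.atlas.W (oc a'))) ∧
            -- the quotient chart is the blow-up chart of the generator `b` of `K(U (oc a'))` lifted by `β`
            ∃ b : Γ(S.V, S.atlas.U (oc a')),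
              b ∈ ((((R.piece Dg).comap S.i).subschemeι ≫ S.q).ker).ideal (S.atlas.U (oc a')) ∧
              S.i.app (S.atlas.W (oc a')) β =
                S.q.appLE (S.atlas.U (oc a')) (S.i ⁻¹ᵁ (S.atlas.W (oc a'))) (S.atlas.preimage_eq (oc a')).le b ∧
              (𝒜'.U a' : V'.Opens) =
                blowupChart ρ ((((R.piece Dg).comap S.i).subschemeι ≫ S.q).ker) (S.atlas.U (oc a')) b := by
  have hc : R.IsRegularWeightedCentre := hadm.1
  haveI : IsLocallyNoetherian S.Y := LocallyOfFiniteType.isLocallyNoetherian S.f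
  haveI : IsLocallyNoetherian S.V := LocallyOfFiniteType.isLocallyNoetherian S.g
  -- the strict transform maps to `X` (the total transform lies in the strict transform)
  set I' := R'.strictTransformPlus S.i.ker with hI'
  let i' := I'.subschemeι
  have hker : S.i.ker ≤ (i' ≫ R'.πPlus).ker :=
    DatumToEmbedded.StrictTransform.le_ker_subschemeι_comp_πPlus R' S.i.ker
  let σX : I'.subscheme ⟶ S.X := IsClosedImmersion.lift S.i (i' ≫ R'.πPlus) hker
  have hσX : σX ≫ S.i = i' ≫ R'.πPlus := IsClosedImmersion.lift_fac _ _ _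
  -- (hom) of the admissible centre on the charts of the presentation
  have hH := hadm.2.2
  have hhom : ∀ (a : S.atlas.ι) (n : ℕ), @Ideal.IsHomogeneous (Fin S.j → ℤ)
      (AddSubgroup Γ(S.Y, S.atlas.W a)) Γ(S.Y, S.atlas.W a) _ _ _ (S.atlas.piece a) _ _
      (S.atlas.gradedRing a) ((R.piece n).ideal (S.atlas.W a)) := fun a n =>
    @hH S.j (S.atlas.W a) (S.atlas.piece a) (S.atlas.gradedRing a) (S.atlas.appLE_mem a)
      (S.atlas.isHomogeneous_ker a) n
  -- the Veronese degree, the downstairs centre `K ≠ ⊥` and the lift (as in `quotientStep_of_isRegularWeightedCentre`)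
  haveI : CompactSpace S.Y := QuasiCompact.compactSpace_of_compactSpace S.f
  obtain ⟨N₀, hN₀, hexc⟩ :=
    DatumToEmbedded.Exceptional.exists_veroneseExceptional_of_isRegularWeightedCentre R hc R' hR'
  obtain ⟨Dg, hDg, hdvd, hA2, hA3⟩ := DatumToEmbedded.Degree.qs_degree_of_isRegularWeightedCentre S.f S.i S.q S.g
    S.hq S.atlas R hc hhom R' hR' σX hσX N₀ hN₀ hexc
  haveI : QuasiCompact S.q := by
    haveI : QuasiCompact (S.q ≫ S.g) := by rw [S.hq]; infer_instance
    exact .of_comp S.q S.g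
  obtain ⟨hK, hlift⟩ := DatumToEmbedded.Lift.qs_lift_of_not_mem_support S.i S.q R hc R' hR' hξ σX hσX Dg hDg hA3
  -- the blow-up of the downstairs centre and the induced atlas with its chart map / cover / units / dictionary
  obtain ⟨V', ρ, hρ⟩ := exists_isBlowup S.V ((((R.piece Dg).comap S.i).subschemeι ≫ S.q).ker)
  haveI : IsProper ρ := hρ.isProper
  haveI : IsIntegral V' := hρ.isIntegral hK
  obtain ⟨q', hq'⟩ := hlift V' ρ hρ
  obtain ⟨𝒜', oc, hle, hexp, hcov, hunit, hdict⟩ :=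
    DatumToEmbedded.Atlas.gradedAtlas_succ_cover_of_isRegularWeightedCentre S.f S.i S.q S.g S.hq S.atlas R hc hξ hhom
      R' hR' σX hσX Dg hDg (hexc Dg hdvd) hA2 hA3 V' ρ hρ q' hq'
  have hq'' : q' ≫ ρ ≫ S.g = i' ≫ R'.πPlus ≫ S.f := by
    rw [← Category.assoc, hq', Category.assoc, S.hq, ← Category.assoc, hσX, Category.assoc]
  exact ⟨Dg, hDg, V', ρ, inferInstance, inferInstance, hρ, q', hq'', σX, hσX, hq', 𝒜', oc, hle, hexp, hcov, hunit,
    hdict⟩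

end Summit.ResolutionOfSingularities.ResolutionOfSingularities.Cruxes.HypersurfaceCentreConstruction.LocalEngine

end
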